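import Summits.BirchSwinnertonDyer.BirchSwinnertonDyer.Theorems.KolyvaginDepthDoorDepthTableRankTwo664a1TwistBSDQuotient
import Summits.BirchSwinnertonDyer.BirchSwinnertonDyer.Theorems.KolyvaginDepthDoorDepthTableRankTwo916c1TwistBSDQuotient
import Summits.BirchSwinnertonDyer.BirchSwinnertonDyer.Theorems.KolyvaginDepthDoorDepthTableRankTwo944e1TwistBSDQuotient
import Summits.BirchSwinnertonDyer.BirchSwinnertonDyer.Theorems.KolyvaginDepthDoorDepthTableIntrinsic
import Summits.BirchSwinnertonDyer.BirchSwinnertonDyer.Theorems.KolyvaginDepthDoorDepthTableIntrinsicSplit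
import Summits.BirchSwinnertonDyer.BirchSwinnertonDyer.Theorems.KolyvaginDepthDoorDepthTableRowsExactReading944e1
import HarnessLib

/-!
# Route `KolyvaginDepthDoor`, crux `KolyvaginDepthSupplyKN` (stmt-BirchSwinnertonDyer-22820) —
# DEPTH TABLE v16: the SPLIT cell — the rows `664a1`, `916c1`, `944e1` INTRINSIC, UNIFORM IN THE HEEGNER FIELD `K` AND IN THE PRIME `p`

Helper file of the lead prover of line `levelone` (kdd-p1 g20; `--supports stmt-BirchSwinnertonDyer-22820
--as helper`); it closes nothing and BSD is NOT proved by it.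

v13–v15 read each rank-two row at its Heegner field OF RECORD through a kernel-certified minimal model of the twist; v15's `…Uniform`
files made 13 of them uniform in `p`. v16 (`cruxBody_of_twistBSDQuotient_intrinsic_split`, Castella–Sano's SPLIT supply (these three curves are additive at `2` with one multiplicative prime: off W. Zhang's ♠ cell)) removes the field of record and every
hypothesis on the twist model: for each curve below, for EVERY admissible `5 ≤ p < 1000` (good ordinary, `ρ_{E,p^n}` onto — hypotheses,
kernel-certified in the tree at the prime of record; Kodaira–Néron / ♠ uniform in `p`), EVERY imaginary quadratic `K` (`d_K` odd, `∉ {−3,−4}`, `p ∤ d_K`, `p` split in `K`, Heegner) and ANY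
globally minimal model `T` of `E^{(d_K)}`:

  «`ord_{s=1} L(E^{(d_K)}, s) = 1` ∧ `ord_p(L'(T,1)/(Ω_T·Reg_T)) ≤ 1`»  ⟹  the clause of `KolyvaginDepthSupplyKN` at the curve VERBATIM.

So the crux holds at the curve as soon as ANY Heegner twist at ANY admissible prime carries the rank-one BSD-quotient datum (tolerance
`ord_p ≤ 1`); the numerical evidence at the fields of record is the observatory's CERT-TABLE (cert-2; context only).

CONDITIONAL on Stein–Wuthrich 2013 Thm. 1.1, Castella–Sano 2026 Thm. 3, Zanarella 2019 Prop. 2.18, Howard–Zanarella, modularity, Mazur 1978 Cor. 4.1, Burungale–Castella–Skinner 2025 Cor. 1.3.1, GZK, BY NAME; per curve;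
nothing class-wide (the open stub (S♭) is untouched); BSD is NOT proved by any of this.

References: [SteinWuthrich2013] Thm. 1.1; [WZhang2014] L8.4 (1), Thm. 9.1, Hypothesis ♠; [CastellaSano2026] Thm. 3;
[BurungaleCastellaSkinner2025] Cor. 1.3.1; [Darmon2004] Thm. 3.22; [SilvermanAEC2009] VII.5.1, VIII.8, X.4.2; [CremonaAlgorithms1997] Table 1.
-/

set_option linter.dupNamespace false

noncomputable section

open scoped Classical NumberField

namespace Summit.BirchSwinnertonDyer.BirchSwinnertonDyer.Theorems.KolyvaginDepthDoor

open Literature.NumberTheory.EllipticCurves Literature.NumberTheory.EllipticCurves.ModularForms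
  WeierstrassCurve NumberField IsDedekindDomain
open Summit.BirchSwinnertonDyer.BirchSwinnertonDyer.Theorems
open Summit.BirchSwinnertonDyer.BirchSwinnertonDyer.Rank2Observatory
open Summit.BirchSwinnertonDyer.BirchSwinnertonDyer.Rank1Residual
open Summit.BirchSwinnertonDyer.Rank1Residual.Additive

namespace C664a1

/-- **Kodaira–Néron for `664a1` at every `p ≥ 5`** (additive-aware table): `Δ(E₀) = -21248 = ±2^8·83`, `2 ∣ c₄(E₀) = 336` (the
place over `2` is ADDITIVE, not multiplicative), the multiplicative prime `83` has exponent `1`. [cite: SilvermanAEC2009, VII.5 Prop. 5.1 (c), VIII.8]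
[cite: CremonaAlgorithms1997, Table 1 (664a1)] -/
theorem kodairaNeron_of_five_le (p : ℕ) (h5 : 5 ≤ p) :
    haveI := isElliptic_c664a1; haveI := isGloballyMinimal_c664a1;
    ∀ v : HeightOneSpectrum (𝓞 ℚ), ((⟨0, 0, 0, -7, 10⟩ : WeierstrassCurve ℤ).map (Int.castRingHom ℚ)).HasMultiplicativeReductionAt v →
      ¬ p ∣ ((⟨0, 0, 0, -7, 10⟩ : WeierstrassCurve ℤ).map (Int.castRingHom ℚ)).ordMinimalDiscriminant v := by
  haveI := isElliptic_c664a1; haveI := isGloballyMinimal_c664a1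
  refine not_dvd_ordMinimalDiscriminant_of_intModel_table_additive intModel (p := p)
    (Δ₀ := -21248) (c₀ := 336) (by decide +kernel) (by decide +kernel) (B := 8)
    (lt_of_lt_of_le (by norm_num) (Nat.pow_le_pow_right (by norm_num) h5)) ?_
  intro q hq hqP hqd
  have hn : ((-21248 : ℤ).natAbs) = 2 ^ 8 * 83 ^ 1 := by norm_num
  rw [hn] at hqd
  rcases (Nat.Prime.dvd_mul hqP).mp hqd with h1 | h1
  · obtain rfl := (Nat.prime_dvd_prime_iff_eq hqP (by norm_num)).mp (hqP.dvd_of_dvd_pow h1)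
    exact Or.inl (by norm_num)
  · obtain rfl := (Nat.prime_dvd_prime_iff_eq hqP (by norm_num)).mp (hqP.dvd_of_dvd_pow h1)
    exact absurd (Finset.mem_range.mp hq) (by norm_num)

/-- **The Heegner hypothesis for `664a1` from «`2` and `83` split in `K`»**: `N_E ∣ |Δ_min| = 2^8·83`
(`conductorNorm_dvd_minimalDiscriminantNorm`), so every prime of the conductor is `2` or `83` (the conductor `664` itself is not
computed in the tree — `E` is additive at `2`). [cite: SilvermanAEC2009, VIII.8, App. C §16] -/
theorem satisfiesHeegnerHypothesis_conductorNorm_of_rad (K : Type) [Field K]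
    (hH : SatisfiesHeegnerHypothesis 166 K) :
    haveI := isElliptic_c664a1; haveI := isGloballyMinimal_c664a1;
    SatisfiesHeegnerHypothesis (((⟨0, 0, 0, -7, 10⟩ : WeierstrassCurve ℤ).map (Int.castRingHom ℚ)).conductorNorm ℤ) K := by
  haveI := isElliptic_c664a1; haveI := isGloballyMinimal_c664a1
  have hdvd := WeierstrassCurve.conductorNorm_dvd_minimalDiscriminantNorm ((⟨0, 0, 0, -7, 10⟩ : WeierstrassCurve ℤ).map (Int.castRingHom ℚ))
    (WeierstrassCurve.finite_setOf_ordMinimalDiscriminant_ne_zero_holds _)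
  rw [WeierstrassCurve.minimalDiscriminantNorm_int_eq_natAbs_minimalDiscriminantInt_holds,
    Summit.BirchSwinnertonDyer.BirchSwinnertonDyer.Rank1Residual.IntModel.minimalDiscriminantInt_eq intModel] at hdvd
  have hΔ : ((⟨0, 0, 0, -7, 10⟩ : WeierstrassCurve ℤ).Δ).natAbs = 2 ^ 8 * 83 ^ 1 := by decide +kernel
  rw [hΔ] at hdvd
  intro q hq hqN
  have hq' : q ∣ 2 ^ 8 * 83 ^ 1 := dvd_trans hqN hdvd
  apply hH q hq
  rcases (Nat.Prime.dvd_mul hq).mp hq' with h1 | h1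
  · obtain rfl := (Nat.prime_dvd_prime_iff_eq hq (by norm_num)).mp (hq.dvd_of_dvd_pow h1); norm_num
  · obtain rfl := (Nat.prime_dvd_prime_iff_eq hq (by norm_num)).mp (hq.dvd_of_dvd_pow h1); norm_num

/-- **THE CRUX `KolyvaginDepthSupplyKN` AT `664a1` — INTRINSIC ROW ON THE SPLIT CELL, UNIFORM IN THE HEEGNER FIELD AND IN THE PRIME (depth table
v16).** `664a1` is additive at `2` with ONE multiplicative prime (`83`): off W. Zhang's ♠ cell, so the supply is Castella–Sano's (split). For
EVERY admissible `5 ≤ p < 1000` (good ordinary, `ρ_{E,p^n}` onto — hypotheses; Kodaira–Néron holds at every `p ≥ 5`), EVERY imaginary quadratic `K`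
with `d_K` odd, `∉ {−3,−4}`, `p ∤ d_K`, `p` SPLIT in `K`, `2` and `83` split in `K` (Heegner), and ANY globally minimal model `T` of `E^{(d_K)}`
(no arithmetic hypothesis on `T`): IF `ord_{s=1} L(E^{(d_K)}, s) = 1` and `ord_p(L'(T,1)/(Ω_T·Reg_T)) ≤ 1`, THEN the clause of
`KolyvaginDepthSupplyKN` holds at `W = 664a1` VERBATIM (generic `cruxBody_of_twistBSDQuotient_intrinsic_split` at the kernel certificates:
non-CM, `2 ≤ rank`, `N ≤ 30 000`). CONDITIONAL on Stein–Wuthrich Thm. 1.1, Castella–Sano Thm. 3, Zanarella 2.18,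
Howard–Zanarella, modularity, Mazur Cor. 4.1, BCS 2025 Cor. 1.3.1, GZK by name; per curve; nothing class-wide; BSD is not proved by it.
[cite: SteinWuthrich2013, Thm. 1.1 (p. 1758)] [cite: CastellaSano2026, Thm. 3] [cite: BurungaleCastellaSkinner2025, Cor. 1.3.1 (p. 4)]
[cite: CremonaAlgorithms1997, Table 1 (664a1)] -/
theorem cruxBody_intrinsic_split_at
    (hSW : SteinWuthrich2013_sha_inf_torsionBy_eq_bot_of_two_le_rank)
    (h3 : Literature.NumberTheory.EllipticCurves.CastellaSano2026_kolyvaginClass_selmerDivisibility_eq_padicValNat_tamagawaProduct)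
    (hZ : Literature.NumberTheory.EllipticCurves.Zanarella2019_kolyvaginClass_one_ne_zero_of_not_selmerDivisible)
    (hHZ : Literature.NumberTheory.EllipticCurves.HowardZanarella_exists_minimal_kolyvaginClass_one_selmerCard_of_ne_zero)
    (hnf : exists_isNewformOf) (hMaz : mazur_not_dvd_maninConstant_of_odd)
    (hBCS : BurungaleCastellaSkinner2025.cor131_padicValRat_bsd_rank_le_one)
    (hGZK : rank_eq_analyticRank_of_analyticRank_le_one)
    (p : ℕ) [hp : Fact p.Prime] (h5 : 5 ≤ p) (hp1000 : p < 1000)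
    (hgood : haveI := isElliptic_c664a1; haveI := isGloballyMinimal_c664a1; ((⟨0, 0, 0, -7, 10⟩ : WeierstrassCurve ℤ).map (Int.castRingHom ℚ)).HasGoodReductionAtPrime p)
    (hord : haveI := isElliptic_c664a1; haveI := isGloballyMinimal_c664a1; ¬ (p : ℤ) ∣ ((⟨0, 0, 0, -7, 10⟩ : WeierstrassCurve ℤ).map (Int.castRingHom ℚ)).frobeniusTrace p)
    (htower : haveI := isElliptic_c664a1; haveI := isGloballyMinimal_c664a1; ∀ n : ℕ, ((⟨0, 0, 0, -7, 10⟩ : WeierstrassCurve ℤ).map (Int.castRingHom ℚ)).HasSurjectiveModNGaloisRep (p ^ n : ℕ))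
    (K : Type) [Field K] [NumberField K] (hK : IsImaginaryQuadratic K)
    (hodd : Odd (NumberField.discr K)) (hD3 : NumberField.discr K ≠ -3) (hD4 : NumberField.discr K ≠ -4)
    (hpD : ¬ ((p : ℤ) ∣ NumberField.discr K)) (hspl : SatisfiesHeegnerHypothesis p K)
    (hH : SatisfiesHeegnerHypothesis 166 K)
    (T : WeierstrassCurve ℚ) [T.IsElliptic] [T.IsGloballyMinimal] (C : WeierstrassCurve.VariableChange ℚ)
    (hC : C • T = ((⟨0, 0, 0, -7, 10⟩ : WeierstrassCurve ℤ).map (Int.castRingHom ℚ)).quadraticTwist (NumberField.discr K : ℚ))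
    (hTr : (((⟨0, 0, 0, -7, 10⟩ : WeierstrassCurve ℤ).map (Int.castRingHom ℚ)).quadraticTwist (NumberField.discr K : ℚ)).analyticRank = 1)
    (hval : ∀ q : ℚ, T.leadingLCoeff / ((T.realPeriodRat * T.regulator : ℝ) : ℂ) = (q : ℂ) → padicValRat p q ≤ 1) :
    haveI := isElliptic_c664a1; haveI := isGloballyMinimal_c664a1;
    ∃ (p : ℕ) (hp : Fact p.Prime), 5 ≤ p ∧ ((⟨0, 0, 0, -7, 10⟩ : WeierstrassCurve ℤ).map (Int.castRingHom ℚ)).HasGoodReductionAtPrime p ∧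
      ¬ (p : ℤ) ∣ ((⟨0, 0, 0, -7, 10⟩ : WeierstrassCurve ℤ).map (Int.castRingHom ℚ)).frobeniusTrace p ∧ (∀ n : ℕ, ((⟨0, 0, 0, -7, 10⟩ : WeierstrassCurve ℤ).map (Int.castRingHom ℚ)).HasSurjectiveModNGaloisRep (p ^ n : ℕ)) ∧
      (∀ v : HeightOneSpectrum (𝓞 ℚ), ((⟨0, 0, 0, -7, 10⟩ : WeierstrassCurve ℤ).map (Int.castRingHom ℚ)).HasMultiplicativeReductionAt v →
        ¬ p ∣ ((⟨0, 0, 0, -7, 10⟩ : WeierstrassCurve ℤ).map (Int.castRingHom ℚ)).ordMinimalDiscriminant v) ∧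
      ∃ (K : Type) (_ : Field K) (_ : NumberField K), IsImaginaryQuadratic K ∧
        NumberField.discr K ≠ -3 ∧ NumberField.discr K ≠ -4 ∧
        ∃ (_ : NeZero (((⟨0, 0, 0, -7, 10⟩ : WeierstrassCurve ℤ).map (Int.castRingHom ℚ)).conductorNorm ℤ)), SatisfiesHeegnerHypothesis (((⟨0, 0, 0, -7, 10⟩ : WeierstrassCurve ℤ).map (Int.castRingHom ℚ)).conductorNorm ℤ) K ∧
        ∃ (Dt : ModularParametrizationData ((⟨0, 0, 0, -7, 10⟩ : WeierstrassCurve ℤ).map (Int.castRingHom ℚ)) (((⟨0, 0, 0, -7, 10⟩ : WeierstrassCurve ℤ).map (Int.castRingHom ℚ)).conductorNorm ℤ)) (β : ℤ) (ι : K →+* ℂ) (n₁ : ℕ)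
          (d : KolyvaginHeegnerData Dt β ι n₁), Squarefree n₁ ∧
          (∀ q ∈ n₁.primeFactors, Zhang2014.IsKolyvaginPrime (((⟨0, 0, 0, -7, 10⟩ : WeierstrassCurve ℤ).map (Int.castRingHom ℚ)).conductorNorm ℤ) ((⟨0, 0, 0, -7, 10⟩ : WeierstrassCurve ℤ).map (Int.castRingHom ℚ)) K p q) ∧
          d.kolyvaginClass hp.out 1 ≠ 0 ∧
          (n₁.primeFactors.card + 1 ≤ ((⟨0, 0, 0, -7, 10⟩ : WeierstrassCurve ℤ).map (Int.castRingHom ℚ)).mordellWeilRank ∨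
            (n₁.primeFactors.card ≤ ((⟨0, 0, 0, -7, 10⟩ : WeierstrassCurve ℤ).map (Int.castRingHom ℚ)).mordellWeilRank ∧
              n₁.primeFactors.card + 1 ≤ (((⟨0, 0, 0, -7, 10⟩ : WeierstrassCurve ℤ).map (Int.castRingHom ℚ)).quadraticTwist (NumberField.discr K : ℚ)).mordellWeilRank)) := by
  haveI := isElliptic_c664a1; haveI := isGloballyMinimal_c664a1
  haveI iNZ : NeZero (((⟨0, 0, 0, -7, 10⟩ : WeierstrassCurve ℤ).map (Int.castRingHom ℚ)).conductorNorm ℤ) := neZero_conductorNorm_of_isElliptic _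
  have hHN := satisfiesHeegnerHypothesis_conductorNorm_of_rad K hH
  have hN : ((⟨0, 0, 0, -7, 10⟩ : WeierstrassCurve ℤ).map (Int.castRingHom ℚ)).conductorNorm ℤ ≤ 30000 := by
    have hdvd := WeierstrassCurve.conductorNorm_dvd_minimalDiscriminantNorm ((⟨0, 0, 0, -7, 10⟩ : WeierstrassCurve ℤ).map (Int.castRingHom ℚ))
      (WeierstrassCurve.finite_setOf_ordMinimalDiscriminant_ne_zero_holds _)
    rw [WeierstrassCurve.minimalDiscriminantNorm_int_eq_natAbs_minimalDiscriminantInt_holds,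
      Summit.BirchSwinnertonDyer.BirchSwinnertonDyer.Rank1Residual.IntModel.minimalDiscriminantInt_eq intModel] at hdvd
    exact (Nat.le_of_dvd (by decide +kernel) hdvd).trans (by decide +kernel)
  exact cruxBody_of_twistBSDQuotient_intrinsic_split hSW h3 hZ hHZ hnf hMaz hBCS hGZK _ not_hasCM KernelCerts001.C664a1.two_le_rank hN p h5 hp1000
    hgood hord htower (kodairaNeron_of_five_le p h5) K hK hodd hD3 hD4 hpD hspl hHN T C hC hTr 1 KernelCerts001.C664a1.two_le_rank hval

end C664a1

namespace C916c1

/-- **Kodaira–Néron for `916c1` at every `p ≥ 5`** (additive-aware table): `Δ(E₀) = 3664 = ±2^4·229`, `2 ∣ c₄(E₀) = 192` (the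
place over `2` is ADDITIVE, not multiplicative), the multiplicative prime `229` has exponent `1`. [cite: SilvermanAEC2009, VII.5 Prop. 5.1 (c), VIII.8]
[cite: CremonaAlgorithms1997, Table 1 (916c1)] -/
theorem kodairaNeron_of_five_le (p : ℕ) (h5 : 5 ≤ p) :
    haveI := isElliptic_c916c1; haveI := isGloballyMinimal_c916c1;
    ∀ v : HeightOneSpectrum (𝓞 ℚ), ((⟨0, 0, 0, -4, 1⟩ : WeierstrassCurve ℤ).map (Int.castRingHom ℚ)).HasMultiplicativeReductionAt v →
      ¬ p ∣ ((⟨0, 0, 0, -4, 1⟩ : WeierstrassCurve ℤ).map (Int.castRingHom ℚ)).ordMinimalDiscriminant v := by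
  haveI := isElliptic_c916c1; haveI := isGloballyMinimal_c916c1
  refine not_dvd_ordMinimalDiscriminant_of_intModel_table_additive intModel (p := p)
    (Δ₀ := 3664) (c₀ := 192) (by decide +kernel) (by decide +kernel) (B := 6)
    (lt_of_lt_of_le (by norm_num) (Nat.pow_le_pow_right (by norm_num) h5)) ?_
  intro q hq hqP hqd
  have hn : ((3664 : ℤ).natAbs) = 2 ^ 4 * 229 ^ 1 := by norm_num
  rw [hn] at hqd
  rcases (Nat.Prime.dvd_mul hqP).mp hqd with h1 | h1
  · obtain rfl := (Nat.prime_dvd_prime_iff_eq hqP (by norm_num)).mp (hqP.dvd_of_dvd_pow h1)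
    exact Or.inl (by norm_num)
  · obtain rfl := (Nat.prime_dvd_prime_iff_eq hqP (by norm_num)).mp (hqP.dvd_of_dvd_pow h1)
    exact absurd (Finset.mem_range.mp hq) (by norm_num)

/-- **The Heegner hypothesis for `916c1` from «`2` and `229` split in `K`»**: `N_E ∣ |Δ_min| = 2^4·229`
(`conductorNorm_dvd_minimalDiscriminantNorm`), so every prime of the conductor is `2` or `229` (the conductor `916` itself is not
computed in the tree — `E` is additive at `2`). [cite: SilvermanAEC2009, VIII.8, App. C §16] -/
theorem satisfiesHeegnerHypothesis_conductorNorm_of_rad (K : Type) [Field K]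
    (hH : SatisfiesHeegnerHypothesis 458 K) :
    haveI := isElliptic_c916c1; haveI := isGloballyMinimal_c916c1;
    SatisfiesHeegnerHypothesis (((⟨0, 0, 0, -4, 1⟩ : WeierstrassCurve ℤ).map (Int.castRingHom ℚ)).conductorNorm ℤ) K := by
  haveI := isElliptic_c916c1; haveI := isGloballyMinimal_c916c1
  have hdvd := WeierstrassCurve.conductorNorm_dvd_minimalDiscriminantNorm ((⟨0, 0, 0, -4, 1⟩ : WeierstrassCurve ℤ).map (Int.castRingHom ℚ))
    (WeierstrassCurve.finite_setOf_ordMinimalDiscriminant_ne_zero_holds _)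
  rw [WeierstrassCurve.minimalDiscriminantNorm_int_eq_natAbs_minimalDiscriminantInt_holds,
    Summit.BirchSwinnertonDyer.BirchSwinnertonDyer.Rank1Residual.IntModel.minimalDiscriminantInt_eq intModel] at hdvd
  have hΔ : ((⟨0, 0, 0, -4, 1⟩ : WeierstrassCurve ℤ).Δ).natAbs = 2 ^ 4 * 229 ^ 1 := by decide +kernel
  rw [hΔ] at hdvd
  intro q hq hqN
  have hq' : q ∣ 2 ^ 4 * 229 ^ 1 := dvd_trans hqN hdvd
  apply hH q hq
  rcases (Nat.Prime.dvd_mul hq).mp hq' with h1 | h1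
  · obtain rfl := (Nat.prime_dvd_prime_iff_eq hq (by norm_num)).mp (hq.dvd_of_dvd_pow h1); norm_num
  · obtain rfl := (Nat.prime_dvd_prime_iff_eq hq (by norm_num)).mp (hq.dvd_of_dvd_pow h1); norm_num

/-- **THE CRUX `KolyvaginDepthSupplyKN` AT `916c1` — INTRINSIC ROW ON THE SPLIT CELL, UNIFORM IN THE HEEGNER FIELD AND IN THE PRIME (depth table
v16).** `916c1` is additive at `2` with ONE multiplicative prime (`229`): off W. Zhang's ♠ cell, so the supply is Castella–Sano's (split). For
EVERY admissible `5 ≤ p < 1000` (good ordinary, `ρ_{E,p^n}` onto — hypotheses; Kodaira–Néron holds at every `p ≥ 5`), EVERY imaginary quadratic `K`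
with `d_K` odd, `∉ {−3,−4}`, `p ∤ d_K`, `p` SPLIT in `K`, `2` and `229` split in `K` (Heegner), and ANY globally minimal model `T` of `E^{(d_K)}`
(no arithmetic hypothesis on `T`): IF `ord_{s=1} L(E^{(d_K)}, s) = 1` and `ord_p(L'(T,1)/(Ω_T·Reg_T)) ≤ 1`, THEN the clause of
`KolyvaginDepthSupplyKN` holds at `W = 916c1` VERBATIM (generic `cruxBody_of_twistBSDQuotient_intrinsic_split` at the kernel certificates:
non-CM, `2 ≤ rank`, `N ≤ 30 000`). CONDITIONAL on Stein–Wuthrich Thm. 1.1, Castella–Sano Thm. 3, Zanarella 2.18,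
Howard–Zanarella, modularity, Mazur Cor. 4.1, BCS 2025 Cor. 1.3.1, GZK by name; per curve; nothing class-wide; BSD is not proved by it.
[cite: SteinWuthrich2013, Thm. 1.1 (p. 1758)] [cite: CastellaSano2026, Thm. 3] [cite: BurungaleCastellaSkinner2025, Cor. 1.3.1 (p. 4)]
[cite: CremonaAlgorithms1997, Table 1 (916c1)] -/
theorem cruxBody_intrinsic_split_at
    (hSW : SteinWuthrich2013_sha_inf_torsionBy_eq_bot_of_two_le_rank)
    (h3 : Literature.NumberTheory.EllipticCurves.CastellaSano2026_kolyvaginClass_selmerDivisibility_eq_padicValNat_tamagawaProduct)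
    (hZ : Literature.NumberTheory.EllipticCurves.Zanarella2019_kolyvaginClass_one_ne_zero_of_not_selmerDivisible)
    (hHZ : Literature.NumberTheory.EllipticCurves.HowardZanarella_exists_minimal_kolyvaginClass_one_selmerCard_of_ne_zero)
    (hnf : exists_isNewformOf) (hMaz : mazur_not_dvd_maninConstant_of_odd)
    (hBCS : BurungaleCastellaSkinner2025.cor131_padicValRat_bsd_rank_le_one)
    (hGZK : rank_eq_analyticRank_of_analyticRank_le_one)
    (p : ℕ) [hp : Fact p.Prime] (h5 : 5 ≤ p) (hp1000 : p < 1000)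
    (hgood : haveI := isElliptic_c916c1; haveI := isGloballyMinimal_c916c1; ((⟨0, 0, 0, -4, 1⟩ : WeierstrassCurve ℤ).map (Int.castRingHom ℚ)).HasGoodReductionAtPrime p)
    (hord : haveI := isElliptic_c916c1; haveI := isGloballyMinimal_c916c1; ¬ (p : ℤ) ∣ ((⟨0, 0, 0, -4, 1⟩ : WeierstrassCurve ℤ).map (Int.castRingHom ℚ)).frobeniusTrace p)
    (htower : haveI := isElliptic_c916c1; haveI := isGloballyMinimal_c916c1; ∀ n : ℕ, ((⟨0, 0, 0, -4, 1⟩ : WeierstrassCurve ℤ).map (Int.castRingHom ℚ)).HasSurjectiveModNGaloisRep (p ^ n : ℕ))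
    (K : Type) [Field K] [NumberField K] (hK : IsImaginaryQuadratic K)
    (hodd : Odd (NumberField.discr K)) (hD3 : NumberField.discr K ≠ -3) (hD4 : NumberField.discr K ≠ -4)
    (hpD : ¬ ((p : ℤ) ∣ NumberField.discr K)) (hspl : SatisfiesHeegnerHypothesis p K)
    (hH : SatisfiesHeegnerHypothesis 458 K)
    (T : WeierstrassCurve ℚ) [T.IsElliptic] [T.IsGloballyMinimal] (C : WeierstrassCurve.VariableChange ℚ)
    (hC : C • T = ((⟨0, 0, 0, -4, 1⟩ : WeierstrassCurve ℤ).map (Int.castRingHom ℚ)).quadraticTwist (NumberField.discr K : ℚ))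
    (hTr : (((⟨0, 0, 0, -4, 1⟩ : WeierstrassCurve ℤ).map (Int.castRingHom ℚ)).quadraticTwist (NumberField.discr K : ℚ)).analyticRank = 1)
    (hval : ∀ q : ℚ, T.leadingLCoeff / ((T.realPeriodRat * T.regulator : ℝ) : ℂ) = (q : ℂ) → padicValRat p q ≤ 1) :
    haveI := isElliptic_c916c1; haveI := isGloballyMinimal_c916c1;
    ∃ (p : ℕ) (hp : Fact p.Prime), 5 ≤ p ∧ ((⟨0, 0, 0, -4, 1⟩ : WeierstrassCurve ℤ).map (Int.castRingHom ℚ)).HasGoodReductionAtPrime p ∧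
      ¬ (p : ℤ) ∣ ((⟨0, 0, 0, -4, 1⟩ : WeierstrassCurve ℤ).map (Int.castRingHom ℚ)).frobeniusTrace p ∧ (∀ n : ℕ, ((⟨0, 0, 0, -4, 1⟩ : WeierstrassCurve ℤ).map (Int.castRingHom ℚ)).HasSurjectiveModNGaloisRep (p ^ n : ℕ)) ∧
      (∀ v : HeightOneSpectrum (𝓞 ℚ), ((⟨0, 0, 0, -4, 1⟩ : WeierstrassCurve ℤ).map (Int.castRingHom ℚ)).HasMultiplicativeReductionAt v →
        ¬ p ∣ ((⟨0, 0, 0, -4, 1⟩ : WeierstrassCurve ℤ).map (Int.castRingHom ℚ)).ordMinimalDiscriminant v) ∧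
      ∃ (K : Type) (_ : Field K) (_ : NumberField K), IsImaginaryQuadratic K ∧
        NumberField.discr K ≠ -3 ∧ NumberField.discr K ≠ -4 ∧
        ∃ (_ : NeZero (((⟨0, 0, 0, -4, 1⟩ : WeierstrassCurve ℤ).map (Int.castRingHom ℚ)).conductorNorm ℤ)), SatisfiesHeegnerHypothesis (((⟨0, 0, 0, -4, 1⟩ : WeierstrassCurve ℤ).map (Int.castRingHom ℚ)).conductorNorm ℤ) K ∧
        ∃ (Dt : ModularParametrizationData ((⟨0, 0, 0, -4, 1⟩ : WeierstrassCurve ℤ).map (Int.castRingHom ℚ)) (((⟨0, 0, 0, -4, 1⟩ : WeierstrassCurve ℤ).map (Int.castRingHom ℚ)).conductorNorm ℤ)) (β : ℤ) (ι : K →+* ℂ) (n₁ : ℕ)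
          (d : KolyvaginHeegnerData Dt β ι n₁), Squarefree n₁ ∧
          (∀ q ∈ n₁.primeFactors, Zhang2014.IsKolyvaginPrime (((⟨0, 0, 0, -4, 1⟩ : WeierstrassCurve ℤ).map (Int.castRingHom ℚ)).conductorNorm ℤ) ((⟨0, 0, 0, -4, 1⟩ : WeierstrassCurve ℤ).map (Int.castRingHom ℚ)) K p q) ∧
          d.kolyvaginClass hp.out 1 ≠ 0 ∧
          (n₁.primeFactors.card + 1 ≤ ((⟨0, 0, 0, -4, 1⟩ : WeierstrassCurve ℤ).map (Int.castRingHom ℚ)).mordellWeilRank ∨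
            (n₁.primeFactors.card ≤ ((⟨0, 0, 0, -4, 1⟩ : WeierstrassCurve ℤ).map (Int.castRingHom ℚ)).mordellWeilRank ∧
              n₁.primeFactors.card + 1 ≤ (((⟨0, 0, 0, -4, 1⟩ : WeierstrassCurve ℤ).map (Int.castRingHom ℚ)).quadraticTwist (NumberField.discr K : ℚ)).mordellWeilRank)) := by
  haveI := isElliptic_c916c1; haveI := isGloballyMinimal_c916c1
  haveI iNZ : NeZero (((⟨0, 0, 0, -4, 1⟩ : WeierstrassCurve ℤ).map (Int.castRingHom ℚ)).conductorNorm ℤ) := neZero_conductorNorm_of_isElliptic _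
  have hHN := satisfiesHeegnerHypothesis_conductorNorm_of_rad K hH
  have hN : ((⟨0, 0, 0, -4, 1⟩ : WeierstrassCurve ℤ).map (Int.castRingHom ℚ)).conductorNorm ℤ ≤ 30000 := by
    have hdvd := WeierstrassCurve.conductorNorm_dvd_minimalDiscriminantNorm ((⟨0, 0, 0, -4, 1⟩ : WeierstrassCurve ℤ).map (Int.castRingHom ℚ))
      (WeierstrassCurve.finite_setOf_ordMinimalDiscriminant_ne_zero_holds _)
    rw [WeierstrassCurve.minimalDiscriminantNorm_int_eq_natAbs_minimalDiscriminantInt_holds,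
      Summit.BirchSwinnertonDyer.BirchSwinnertonDyer.Rank1Residual.IntModel.minimalDiscriminantInt_eq intModel] at hdvd
    exact (Nat.le_of_dvd (by decide +kernel) hdvd).trans (by decide +kernel)
  exact cruxBody_of_twistBSDQuotient_intrinsic_split hSW h3 hZ hHZ hnf hMaz hBCS hGZK _ not_hasCM KernelCerts002.C916c1.two_le_rank hN p h5 hp1000
    hgood hord htower (kodairaNeron_of_five_le p h5) K hK hodd hD3 hD4 hpD hspl hHN T C hC hTr 1 KernelCerts002.C916c1.two_le_rank hval

end C916c1

namespace C944e1

/-- **Kodaira–Néron for `944e1` at every `p ≥ 5`** (additive-aware table): `Δ(E₀) = -60416 = ±2^10·59`, `2 ∣ c₄(E₀) = 912` (the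
place over `2` is ADDITIVE, not multiplicative), the multiplicative prime `59` has exponent `1`. [cite: SilvermanAEC2009, VII.5 Prop. 5.1 (c), VIII.8]
[cite: CremonaAlgorithms1997, Table 1 (944e1)] -/
theorem kodairaNeron_of_five_le (p : ℕ) (h5 : 5 ≤ p) :
    haveI := isElliptic_c944e1; haveI := isGloballyMinimal_c944e1;
    ∀ v : HeightOneSpectrum (𝓞 ℚ), ((⟨0, 0, 0, -19, 34⟩ : WeierstrassCurve ℤ).map (Int.castRingHom ℚ)).HasMultiplicativeReductionAt v →
      ¬ p ∣ ((⟨0, 0, 0, -19, 34⟩ : WeierstrassCurve ℤ).map (Int.castRingHom ℚ)).ordMinimalDiscriminant v := by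
  haveI := isElliptic_c944e1; haveI := isGloballyMinimal_c944e1
  refine not_dvd_ordMinimalDiscriminant_of_intModel_table_additive intModel (p := p)
    (Δ₀ := -60416) (c₀ := 912) (by decide +kernel) (by decide +kernel) (B := 11)
    (lt_of_lt_of_le (by norm_num) (Nat.pow_le_pow_right (by norm_num) h5)) ?_
  intro q hq hqP hqd
  have hn : ((-60416 : ℤ).natAbs) = 2 ^ 10 * 59 ^ 1 := by norm_num
  rw [hn] at hqd
  rcases (Nat.Prime.dvd_mul hqP).mp hqd with h1 | h1
  · obtain rfl := (Nat.prime_dvd_prime_iff_eq hqP (by norm_num)).mp (hqP.dvd_of_dvd_pow h1)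
    exact Or.inl (by norm_num)
  · obtain rfl := (Nat.prime_dvd_prime_iff_eq hqP (by norm_num)).mp (hqP.dvd_of_dvd_pow h1)
    exact absurd (Finset.mem_range.mp hq) (by norm_num)

/-- **The Heegner hypothesis for `944e1` from «`2` and `59` split in `K`»**: `N_E ∣ |Δ_min| = 2^10·59`
(`conductorNorm_dvd_minimalDiscriminantNorm`), so every prime of the conductor is `2` or `59` (the conductor `944` itself is not
computed in the tree — `E` is additive at `2`). [cite: SilvermanAEC2009, VIII.8, App. C §16] -/
theorem satisfiesHeegnerHypothesis_conductorNorm_of_rad (K : Type) [Field K]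
    (hH : SatisfiesHeegnerHypothesis 118 K) :
    haveI := isElliptic_c944e1; haveI := isGloballyMinimal_c944e1;
    SatisfiesHeegnerHypothesis (((⟨0, 0, 0, -19, 34⟩ : WeierstrassCurve ℤ).map (Int.castRingHom ℚ)).conductorNorm ℤ) K := by
  haveI := isElliptic_c944e1; haveI := isGloballyMinimal_c944e1
  have hdvd := WeierstrassCurve.conductorNorm_dvd_minimalDiscriminantNorm ((⟨0, 0, 0, -19, 34⟩ : WeierstrassCurve ℤ).map (Int.castRingHom ℚ))
    (WeierstrassCurve.finite_setOf_ordMinimalDiscriminant_ne_zero_holds _)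
  rw [WeierstrassCurve.minimalDiscriminantNorm_int_eq_natAbs_minimalDiscriminantInt_holds,
    Summit.BirchSwinnertonDyer.BirchSwinnertonDyer.Rank1Residual.IntModel.minimalDiscriminantInt_eq intModel] at hdvd
  have hΔ : ((⟨0, 0, 0, -19, 34⟩ : WeierstrassCurve ℤ).Δ).natAbs = 2 ^ 10 * 59 ^ 1 := by decide +kernel
  rw [hΔ] at hdvd
  intro q hq hqN
  have hq' : q ∣ 2 ^ 10 * 59 ^ 1 := dvd_trans hqN hdvd
  apply hH q hq
  rcases (Nat.Prime.dvd_mul hq).mp hq' with h1 | h1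
  · obtain rfl := (Nat.prime_dvd_prime_iff_eq hq (by norm_num)).mp (hq.dvd_of_dvd_pow h1); norm_num
  · obtain rfl := (Nat.prime_dvd_prime_iff_eq hq (by norm_num)).mp (hq.dvd_of_dvd_pow h1); norm_num

/-- **THE CRUX `KolyvaginDepthSupplyKN` AT `944e1` — INTRINSIC ROW ON THE SPLIT CELL, UNIFORM IN THE HEEGNER FIELD AND IN THE PRIME (depth table
v16).** `944e1` is additive at `2` with ONE multiplicative prime (`59`): off W. Zhang's ♠ cell, so the supply is Castella–Sano's (split). For
EVERY admissible `5 ≤ p < 1000` (good ordinary, `ρ_{E,p^n}` onto — hypotheses; Kodaira–Néron holds at every `p ≥ 5`), EVERY imaginary quadratic `K`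
with `d_K` odd, `∉ {−3,−4}`, `p ∤ d_K`, `p` SPLIT in `K`, `2` and `59` split in `K` (Heegner), and ANY globally minimal model `T` of `E^{(d_K)}`
(no arithmetic hypothesis on `T`): IF `ord_{s=1} L(E^{(d_K)}, s) = 1` and `ord_p(L'(T,1)/(Ω_T·Reg_T)) ≤ 1`, THEN the clause of
`KolyvaginDepthSupplyKN` holds at `W = 944e1` VERBATIM (generic `cruxBody_of_twistBSDQuotient_intrinsic_split` at the kernel certificates:
non-CM, `2 ≤ rank`, `N ≤ 30 000`). CONDITIONAL on Stein–Wuthrich Thm. 1.1, Castella–Sano Thm. 3, Zanarella 2.18,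
Howard–Zanarella, modularity, Mazur Cor. 4.1, BCS 2025 Cor. 1.3.1, GZK by name; per curve; nothing class-wide; BSD is not proved by it.
[cite: SteinWuthrich2013, Thm. 1.1 (p. 1758)] [cite: CastellaSano2026, Thm. 3] [cite: BurungaleCastellaSkinner2025, Cor. 1.3.1 (p. 4)]
[cite: CremonaAlgorithms1997, Table 1 (944e1)] -/
theorem cruxBody_intrinsic_split_at
    (hSW : SteinWuthrich2013_sha_inf_torsionBy_eq_bot_of_two_le_rank)
    (h3 : Literature.NumberTheory.EllipticCurves.CastellaSano2026_kolyvaginClass_selmerDivisibility_eq_padicValNat_tamagawaProduct)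
    (hZ : Literature.NumberTheory.EllipticCurves.Zanarella2019_kolyvaginClass_one_ne_zero_of_not_selmerDivisible)
    (hHZ : Literature.NumberTheory.EllipticCurves.HowardZanarella_exists_minimal_kolyvaginClass_one_selmerCard_of_ne_zero)
    (hnf : exists_isNewformOf) (hMaz : mazur_not_dvd_maninConstant_of_odd)
    (hBCS : BurungaleCastellaSkinner2025.cor131_padicValRat_bsd_rank_le_one)
    (hGZK : rank_eq_analyticRank_of_analyticRank_le_one)
    (p : ℕ) [hp : Fact p.Prime] (h5 : 5 ≤ p) (hp1000 : p < 1000)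
    (hgood : haveI := isElliptic_c944e1; haveI := isGloballyMinimal_c944e1; ((⟨0, 0, 0, -19, 34⟩ : WeierstrassCurve ℤ).map (Int.castRingHom ℚ)).HasGoodReductionAtPrime p)
    (hord : haveI := isElliptic_c944e1; haveI := isGloballyMinimal_c944e1; ¬ (p : ℤ) ∣ ((⟨0, 0, 0, -19, 34⟩ : WeierstrassCurve ℤ).map (Int.castRingHom ℚ)).frobeniusTrace p)
    (htower : haveI := isElliptic_c944e1; haveI := isGloballyMinimal_c944e1; ∀ n : ℕ, ((⟨0, 0, 0, -19, 34⟩ : WeierstrassCurve ℤ).map (Int.castRingHom ℚ)).HasSurjectiveModNGaloisRep (p ^ n : ℕ))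
    (K : Type) [Field K] [NumberField K] (hK : IsImaginaryQuadratic K)
    (hodd : Odd (NumberField.discr K)) (hD3 : NumberField.discr K ≠ -3) (hD4 : NumberField.discr K ≠ -4)
    (hpD : ¬ ((p : ℤ) ∣ NumberField.discr K)) (hspl : SatisfiesHeegnerHypothesis p K)
    (hH : SatisfiesHeegnerHypothesis 118 K)
    (T : WeierstrassCurve ℚ) [T.IsElliptic] [T.IsGloballyMinimal] (C : WeierstrassCurve.VariableChange ℚ)
    (hC : C • T = ((⟨0, 0, 0, -19, 34⟩ : WeierstrassCurve ℤ).map (Int.castRingHom ℚ)).quadraticTwist (NumberField.discr K : ℚ))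
    (hTr : (((⟨0, 0, 0, -19, 34⟩ : WeierstrassCurve ℤ).map (Int.castRingHom ℚ)).quadraticTwist (NumberField.discr K : ℚ)).analyticRank = 1)
    (hval : ∀ q : ℚ, T.leadingLCoeff / ((T.realPeriodRat * T.regulator : ℝ) : ℂ) = (q : ℂ) → padicValRat p q ≤ 1) :
    haveI := isElliptic_c944e1; haveI := isGloballyMinimal_c944e1;
    ∃ (p : ℕ) (hp : Fact p.Prime), 5 ≤ p ∧ ((⟨0, 0, 0, -19, 34⟩ : WeierstrassCurve ℤ).map (Int.castRingHom ℚ)).HasGoodReductionAtPrime p ∧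
      ¬ (p : ℤ) ∣ ((⟨0, 0, 0, -19, 34⟩ : WeierstrassCurve ℤ).map (Int.castRingHom ℚ)).frobeniusTrace p ∧ (∀ n : ℕ, ((⟨0, 0, 0, -19, 34⟩ : WeierstrassCurve ℤ).map (Int.castRingHom ℚ)).HasSurjectiveModNGaloisRep (p ^ n : ℕ)) ∧
      (∀ v : HeightOneSpectrum (𝓞 ℚ), ((⟨0, 0, 0, -19, 34⟩ : WeierstrassCurve ℤ).map (Int.castRingHom ℚ)).HasMultiplicativeReductionAt v →
        ¬ p ∣ ((⟨0, 0, 0, -19, 34⟩ : WeierstrassCurve ℤ).map (Int.castRingHom ℚ)).ordMinimalDiscriminant v) ∧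
      ∃ (K : Type) (_ : Field K) (_ : NumberField K), IsImaginaryQuadratic K ∧
        NumberField.discr K ≠ -3 ∧ NumberField.discr K ≠ -4 ∧
        ∃ (_ : NeZero (((⟨0, 0, 0, -19, 34⟩ : WeierstrassCurve ℤ).map (Int.castRingHom ℚ)).conductorNorm ℤ)), SatisfiesHeegnerHypothesis (((⟨0, 0, 0, -19, 34⟩ : WeierstrassCurve ℤ).map (Int.castRingHom ℚ)).conductorNorm ℤ) K ∧
        ∃ (Dt : ModularParametrizationData ((⟨0, 0, 0, -19, 34⟩ : WeierstrassCurve ℤ).map (Int.castRingHom ℚ)) (((⟨0, 0, 0, -19, 34⟩ : WeierstrassCurve ℤ).map (Int.castRingHom ℚ)).conductorNorm ℤ)) (β : ℤ) (ι : K →+* ℂ) (n₁ : ℕ)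
          (d : KolyvaginHeegnerData Dt β ι n₁), Squarefree n₁ ∧
          (∀ q ∈ n₁.primeFactors, Zhang2014.IsKolyvaginPrime (((⟨0, 0, 0, -19, 34⟩ : WeierstrassCurve ℤ).map (Int.castRingHom ℚ)).conductorNorm ℤ) ((⟨0, 0, 0, -19, 34⟩ : WeierstrassCurve ℤ).map (Int.castRingHom ℚ)) K p q) ∧
          d.kolyvaginClass hp.out 1 ≠ 0 ∧
          (n₁.primeFactors.card + 1 ≤ ((⟨0, 0, 0, -19, 34⟩ : WeierstrassCurve ℤ).map (Int.castRingHom ℚ)).mordellWeilRank ∨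
            (n₁.primeFactors.card ≤ ((⟨0, 0, 0, -19, 34⟩ : WeierstrassCurve ℤ).map (Int.castRingHom ℚ)).mordellWeilRank ∧
              n₁.primeFactors.card + 1 ≤ (((⟨0, 0, 0, -19, 34⟩ : WeierstrassCurve ℤ).map (Int.castRingHom ℚ)).quadraticTwist (NumberField.discr K : ℚ)).mordellWeilRank)) := by
  haveI := isElliptic_c944e1; haveI := isGloballyMinimal_c944e1
  haveI iNZ : NeZero (((⟨0, 0, 0, -19, 34⟩ : WeierstrassCurve ℤ).map (Int.castRingHom ℚ)).conductorNorm ℤ) := neZero_conductorNorm_of_isElliptic _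
  have hHN := satisfiesHeegnerHypothesis_conductorNorm_of_rad K hH
  have hN : ((⟨0, 0, 0, -19, 34⟩ : WeierstrassCurve ℤ).map (Int.castRingHom ℚ)).conductorNorm ℤ ≤ 30000 := (Nat.le_of_dvd (by norm_num) conductorNorm_dvd).trans (by norm_num)
  exact cruxBody_of_twistBSDQuotient_intrinsic_split hSW h3 hZ hHZ hnf hMaz hBCS hGZK _ not_hasCM KernelCerts002.C944e1.two_le_rank hN p h5 hp1000
    hgood hord htower (kodairaNeron_of_five_le p h5) K hK hodd hD3 hD4 hpD hspl hHN T C hC hTr 1 KernelCerts002.C944e1.two_le_rank hval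

end C944e1

end Summit.BirchSwinnertonDyer.BirchSwinnertonDyer.Theorems.KolyvaginDepthDoor

end
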